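import Literature.MathematicalPhysics.PowerSystems.QuadraticDroopZIPLoads
import Literature.MathematicalPhysics.PowerSystems.QuadraticDroopInverseOptimality
import HarnessLib

/-!
# Quadratic droop control with DYNAMIC SHUNT loads (Simpson-Porco–Dörfler–Bullo 2017, Theorem 3.5):
# the equilibrium `(E_L^{DS}, E_I^{DS}, b^{DS})` for small constant-power demands and the Hurwitz
# reduced matrix of the linearised extended DAE — a symmetric pencil once the shunt rows are
# scaled by `−1/(2b)`

Topic `Literature/MathematicalPhysics/PowerSystems` (LADDER-GRIDFUSION rung G3.b «droop microgrid
with Q–V dynamics», quadratic-droop lineage; seat gridfusion-lit-2, g15).  Fifth file on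
[SimpsonporcoDorflerBullo2017] = IEEE TAC 62 (2017) 1239–1253 = arXiv:1507.00431 (held text read on the
page this session: §3.3 p0012 L20–L38, Appendix A p0019 L68–L71).  Companions:
`QuadraticDroopVoltageStabilization.lean` (model, Theorem 3.1, Theorem 3.3, Proposition 7.2, Lemma
7.1), `QuadraticDroopReducedJacobianStability.lean` (Theorem 3.2: `jac`, `symJac`, `symJacLL`,
`symJacRed`, `jac_liftState_blocks`, `posDef_neg_symJac`, the reduced matrix), `QuadraticDroopZIPLoads.lean`
(Theorem 3.4: `zipVoltage`, `Qsc`, `zipError`, the certificate `−(B_red + [b]) + [E]⁻²[Q_L] ≻ 0`).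

THE PRINTED MODEL AND THEOREM (p0012 L20–L38).  «A common dynamic load model is the dynamic shunt model
`T_iḃ_dyn-shunt,i = Q_i − E_i²b_dyn-shunt,i`, or in vector notation `Tḃ_dyn-shunt = Q_L − [E_L]²b_dyn-shunt`
(3.16), where `T` is a diagonal matrix of time constants. The model specifies a constant-impedance load
model `Q_i(E_i) = b_dyn-shunt,i E_i²`, with the shunt susceptance dynamically adjusted to achieve a
constant power consumption `Q_i` in steady-state … we assume that `Q_i < 0`.»  «Theorem 3.5 (Stability
with Dynamic Shunt Loads). Consider the reduced power flow equation (3.7) with the dynamic shunt load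
model (3.16) and `Q_i < 0`. If `‖Q_L‖` is sufficiently small, then there exists a unique solution
`(E_L^{DS}, b^{DS}) ∈ ℝ^n_{>0} × ℝ^n_{<0}` of (3.7), (3.16), given by `E_L^{DS} = [E_L*](𝟙 − Q_sc⁻¹Q_L + ε)`,
`b^{DS} = [E_L^{DS}]⁻²Q_L` (3.17)–(3.18), where `Q_sc = [E_L*]B_red[E_L*]` and `‖ε‖ = O(‖Q_sc⁻¹Q_L‖²)`,
and the corresponding equilibrium point `(E_L^{DS}, E_I^{DS}, b^{DS})` of the system (3.3), (3.16) is
locally exponentially stable.»  THE PRINTED PROOF (Appendix A p0019 L68–L71) is a SKETCH: «In steady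
state, the DS model (3.16) is equivalent to a constant-power model, and hence the approximate
steady-state load voltages `E_L^{DS}` are given as in Theorem 3.4 with ZI components `b_shunt = 0` and
`I_shunt = 0`, yielding the stated equilibrium. Stability can no longer be shown by applying Theorem 3.2
… A tedious but straightforward calculation shows that applying the proof methodologies of Theorems 3.2
and 3.4 to the extended dynamics (3.3), (3.16) yields local exponential stability.»

WHAT THIS FILE PROVES (0 named facts).
* §1 the extended closed loop `dsField` ((3.3) with the load model `Q_l(E_l) = b_lE_l²` in which `b` is
  a STATE, plus the shunt rows `Q_l − E_l²b_l`), its equilibria `IsDSEquilibrium`; **`isDSEquilibrium_iff`**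
  («in steady state the DS model is equivalent to a constant-power model»: for nonvanishing load
  voltages, `(E, b)` is an equilibrium iff `b = [E_L]⁻²Q_L` and `E` is an equilibrium of (3.3) with the
  CONSTANT-POWER loads `Q_l`), and with Theorem 3.1 `isDSEquilibrium_iff_reducedPowerFlow`.
* §2 the equilibrium for small `Q_L` = Theorem 3.4 at `b_shunt = I_shunt = 0` BY NAME: `E_L^{ZI} = E_L*`
  (`ziVoltage_zero_zero`), `Q_sc = [E_L*]B_red[E_L*]` (`Qsc_zero_zero`), `dsVoltage Q_L := zipVoltage 0 0 Q_L`,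
  `dsShunt Q_L = [E_L^{DS}]⁻²Q_L`; **`theorem_3_5_equilibrium`**: for all sufficiently small `Q_L` the state
  `(E_L^{DS}, E_I^{DS}, b^{DS})` is an equilibrium of (3.3), (3.16) in `ℝ^{n+m}_{>0} × ℝ^n`, with
  `b^{DS} < 0` iff `Q_L < 0`, `E_L^{DS} = [E_L*](𝟙 − Q_sc⁻¹Q_L + ε)` with `‖ε‖ ≤ C‖Q_sc⁻¹Q_L‖²`, and near
  `(0, E_L*)` the equilibria are exactly these (local uniqueness).
* §3 «the proof methodology of Theorem 3.2 applied to the extended dynamics»: the linearisation of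
  (3.3), (3.16) at an equilibrium `(E_L, W₂(E_L, E_I*), b)` in the variables `(E_L | E_I, b)`
  (algebraic | differential): blocks `dsJLL = J_LL`, `dsJLd = [J_LI, [E_L²]]`, `dsJdL = [J_IL; −2[E_Lb]]`,
  `dsJdd = [J_II, 0; 0, −[E_L²]]` (with `∂Q_l/∂E_l = 2b_lE_l` inside `J`), and **the symmetrised pencil**:
  scaling the load rows by `[E_L]⁻¹`, the inverter rows by `[E_I]⁻¹` (as in Theorem 3.2) and the shunt
  rows by `[−2b]⁻¹` (this is where `b < 0`, i.e. `Q_L < 0`, enters) gives `𝒥 = Λ𝓜` with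
  `𝓜 = [M₁₁ B_LI [E_L]; B_IL B_II+K_I 0; [E_L] 0 [E_L²/(2b)]]` SYMMETRIC (`dsSymJac`, `dsJac_eq_scale_mul`).
  The Schur complement of `𝓜` with respect to its differential block is `[E_L]⁻¹J_red` with `∂Q/∂E = 0`,
  i.e. `B_red − [E_L]⁻²[Q_L]` at a solution (`dsSchur_eq_symJacRed_zero`), whence
  **`posDef_neg_dsSymJac`**: `−𝓜 ≻ 0` as soon as `b < 0`, `−(B_II + K_I) ≻ 0` and the Theorem 3.4
  certificate `−B_red + [E_L]⁻²[Q_L] ≻ 0` holds; the reduced matrix of the linearised DAE (eliminate the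
  algebraic `E_L`: `dsRedStateMatrix = diag(τ, T)⁻¹(𝒥_dd − 𝒥_dL𝒥_LL⁻¹𝒥_Ld)`) equals
  `diag(E_I/τ, −2b/T)·𝓜_red` with `−𝓜_red ≻ 0` (`dsRedStateMatrix_eq`, `posDef_neg_dsMred`), hence is
  HURWITZ with algebraic block `J_LL` invertible (index one) — **`dsRedStateMatrix_isHurwitz`**
  (Horn–Johnson Thm. 7.6.1 (a), tree `isHurwitz_diagonal_mul_of_posDef_neg`).
* §3a **`hasFDerivAt_dsField`** (the extended field is differentiable in `(E, b)` with derivative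
  `(h, k) ↦ (J(E)h + ([E_L²]k, 0), −2[E_Lb]h_L − [E_L²]k)`, `J` = the companion's Jacobian (3.11′) with
  `D_ll = 2b_lE_l`) and **`dsField_fderiv_blocks`** / **`hasFDerivAt_dsField_liftState`**: at
  `(E_L, W₂(E_L, E_I*), b)`, in the variables `(x_L | x_I, x_b)`, this derivative IS the block matrix
  `[[𝒥_LL, 𝒥_Ld], [𝒥_dL, 𝒥_dd]]` of §3.
* §4 assembly **`theorem_3_5_redStateMatrix`**: under Proposition 7.2's matrix-level data, `τ, T > 0` and
  Theorem 3.3 (ii) at `I_shunt = 0` (`B_redE_L* < 0`, cf. `QuadraticDroopInverseOptimality.redSource_neg_of_exists_line`),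
  for ALL SUFFICIENTLY SMALL INDUCTIVE demands `Q_L < 0`: the equilibrium exists as in §2, `b^{DS} < 0`, and
  the reduced matrix of the linearised extended DAE at it is Hurwitz; **`theorem_3_5_redStateMatrix_of_network`**
  from branch data.

THREE COLUMNS / NOT CLAIMED.  Statements about the MODEL (3.3) + (3.16) (decoupled reactive power
flow, quadratic droop, dynamic shunt loads).  STABILITY IS TYPED AT THE TIER THE PRINT PROVES FOR
THEOREM 3.2 — the reduced matrix of the linearised DAE is Hurwitz and the algebraic block is invertible;
the nonlinear DAE conclusion (the [RR:04]/Riaza step the companion carries out for (3.3) in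
`theorem_3_2_locallyExpStable`) is NOT repeated here for the extended system.  The blocks `dsJ··`
(`∂(b_lE_l²)/∂E_l = 2b_lE_l`, `∂(b_lE_l²)/∂b_l = E_l²`; shunt rows `−2E_lb_l`, `−E_l²`; the rest from the
companion's `jacLL/jacLI/jacIL/jacII`) ARE the Fréchet derivative of `(E, b) ↦ dsField Q_L E b` at
`(E_L, W₂(E_L, E_I*), b)` in the variables `(x_L | x_I, x_b)`: §3a `hasFDerivAt_dsField`,
`dsField_fderiv_blocks`, `hasFDerivAt_dsField_liftState`.  «Sufficiently small» =
`∀ᶠ Q_L in 𝓝 0` restricted to `Q_L < 0`; no bound on `‖Q_L‖`; uniqueness is local near `(E_L*, b = 0)`;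
for a GIVEN `Q_L` the certificate road is `dsRedStateMatrix_isHurwitz` (one `n × n` `LDLᵀ` of
`−B_red + [E_L]⁻²[Q_L]` at an enclosed solution).  Nothing here says a microgrid is stable.

## Mathlib / tree search

Tree (used by name): companions as listed; `LinearAlgebra/Matrix/DiagonalSymmetricProduct`
(`isHurwitz_diagonal_mul_of_posDef_neg`).  Mathlib: `Matrix.fromCols/fromRows` algebra
(`fromCols_mul_fromBlocks`, `fromCols_mul_fromRows`, `mul_fromCols`, `fromBlocks_mul_fromRows`,
`conjTranspose_fromCols_eq_fromRows_conjTranspose`), `Matrix.schur_complement_eq₁₁/₂₂`,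
`IsHermitian.fromBlocks₁₁/₂₂`, `Matrix.fromBlocks_diagonal`, `Matrix.posDef_diagonal_iff`,
`Matrix.mul_inv_rev`, `Matrix.inv_eq_right_inv`.

## References

* J. W. Simpson-Porco, F. Dörfler, F. Bullo, *Voltage stabilization in microgrids via quadratic droop
  control*, IEEE Trans. Automat. Control 62 (2017) 1239–1253 = arXiv:1507.00431: §3.3 eq. (3.16) and
  Theorem 3.5 (held text p0012 L20–L38), Appendix A proof sketch (p0019 L68–L71), §3.2 Theorem 3.2 and
  its proof (p0010), Theorem 3.4. [SimpsonporcoDorflerBullo2017]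
* R. A. Horn, C. R. Johnson, *Matrix Analysis*, 2nd ed., CUP 2013, §7.6 Thm. 7.6.1 (a). [HornJohnson2013]
* R. Riaza, *Differential-Algebraic Systems*, World Scientific 2008, §3.1 (linearise, eliminate the
  algebraic equations). [Riaza2008]

AI-produced formalisation (LADDER-GRIDFUSION seat gridfusion-lit-2 g15, 2026-08-28).
-/

noncomputable section

open Finset Filter Set
open scoped Matrix BigOperators Topology

namespace Literature.MathematicalPhysics.PowerSystems

open _root_.Matrix Literature.LinearAlgebra.Matrix
open Literature.MathematicalPhysics.KineticTheory.HeatConduction (IsHurwitz)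

namespace QuadDroopNetwork

variable {n m : ℕ} (W : QuadDroopNetwork n m)

/-- Invertibility of `M` from positive definiteness of `−M` (restated; private in the companions).
[folklore] -/
private theorem isUnit_det_of_posDef_neg₃ {ι : Type*} [Fintype ι] [DecidableEq ι] {M : Matrix ι ι ℝ}
    (h : (-M).PosDef) : IsUnit M.det := by
  have h1 : IsUnit (-M).det := (Matrix.isUnit_iff_isUnit_det _).1 h.isUnit
  rw [Matrix.det_neg, isUnit_iff_ne_zero, mul_ne_zero_iff] at h1
  exact isUnit_iff_ne_zero.2 h1.2

/-- `(−M)⁻¹ = −M⁻¹` for an invertible matrix. [folklore] -/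
private theorem inv_neg_eq₃ {ι : Type*} [Fintype ι] [DecidableEq ι] {M : Matrix ι ι ℝ}
    (hM : IsUnit M.det) : (-M)⁻¹ = -M⁻¹ :=
  Matrix.inv_eq_left_inv (by rw [neg_mul_neg, Matrix.nonsing_inv_mul _ hM])

/-- `diagonal 0 = 0` with the `Pi` zero literal (Mathlib's `diagonal_zero` is stated for `fun _ => 0`).
[folklore] -/
private theorem diagonal_zero' {ι : Type*} [DecidableEq ι] :
    (diagonal (0 : ι → ℝ) : Matrix ι ι ℝ) = 0 := diagonal_zero

/-! ## §1 The extended closed loop (3.3) + (3.16) and its equilibria -/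

/-- **The extended closed loop**: the rows of (3.3) with the load model `Q_l(E_l) = b_lE_l²` in which the
shunt susceptance `b` is a state (algebraic load rows, inverter rows `τ_iĖ_i = …`), followed by the
dynamic shunt rows `T_lḃ_l = Q_l − E_l²b_l` (3.16) (the right-hand sides; the masses `τ`, `T` enter the
linearisation below). [cite: SimpsonporcoDorflerBullo2017, §3.3 eq. (3.16) («`Tḃ_dyn-shunt = Q_L − [E_L]²b_dyn-shunt` … `Q_i(E_i) = b_dyn-shunt,i E_i²`», p0012 L20–L27) with §3.1 eq. (3.3)] -/
def dsField (Q : Fin n → ℝ) (E : Fin n ⊕ Fin m → ℝ) (b : Fin n → ℝ) : (Fin n ⊕ Fin m) ⊕ Fin n → ℝ :=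
  Sum.elim (W.closedLoop (ziLoad b 0) E) fun l => Q l - E (Sum.inl l) ^ 2 * b l

/-- Equilibria of the extended closed loop (3.3), (3.16). [cite: SimpsonporcoDorflerBullo2017, §3.3 Theorem 3.5 («the corresponding equilibrium point `(E_L^{DS}, E_I^{DS}, b_dyn-shunt^{DS})` of the system (3.3), (3.16)»)] -/
def IsDSEquilibrium (Q : Fin n → ℝ) (E : Fin n ⊕ Fin m → ℝ) (b : Fin n → ℝ) : Prop := W.dsField Q E b = 0

variable {W} in
/-- The closed loop depends on the load model only through its values at the load voltages. [folklore] -/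
private theorem closedLoop_congr {QL QL' : Fin n → ℝ → ℝ} {E : Fin n ⊕ Fin m → ℝ}
    (h : ∀ l, QL l (E (Sum.inl l)) = QL' l (E (Sum.inl l))) : W.closedLoop QL E = W.closedLoop QL' E := by
  funext k
  cases k with
  | inl l => simp only [closedLoop, Sum.elim_inl, h l]
  | inr i => simp only [closedLoop, Sum.elim_inr]

variable {W} in
/-- **«In steady state, the DS model (3.16) is equivalent to a constant-power model»**: for nonvanishing
load voltages, `(E, b)` is an equilibrium of (3.3), (3.16) iff `b = [E_L]⁻²Q_L` and `E` is an equilibrium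
of the closed loop (3.3) with the CONSTANT-POWER loads `Q_l(E_l) = Q_l` (the ZIP model with `b = I = 0`).
[cite: SimpsonporcoDorflerBullo2017, Appendix A proof of Theorem 3.5 (p0019 L68–L69) and §3.3 (p0012 L24–L27: «the shunt susceptance … dynamically adjusted to achieve a constant power consumption `Q_i` in steady-state»)] -/
theorem isDSEquilibrium_iff (Q : Fin n → ℝ) {E : Fin n ⊕ Fin m → ℝ} (hEL : ∀ l, E (Sum.inl l) ≠ 0)
    (b : Fin n → ℝ) :
    W.IsDSEquilibrium Q E b ↔
      W.IsEquilibrium (zipLoad 0 0 Q) E ∧ b = fun l => Q l / E (Sum.inl l) ^ 2 := by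
  have hsplit : W.IsDSEquilibrium Q E b ↔
      W.closedLoop (ziLoad b 0) E = 0 ∧ ∀ l, Q l - E (Sum.inl l) ^ 2 * b l = 0 := by
    constructor
    · intro h
      refine ⟨funext fun k => congrFun h (Sum.inl k), fun l => congrFun h (Sum.inr l)⟩
    · rintro ⟨h1, h2⟩
      funext k
      cases k with
      | inl k => exact congrFun h1 k
      | inr l => exact h2 l
  have hshunt : (∀ l, Q l - E (Sum.inl l) ^ 2 * b l = 0) ↔ b = fun l => Q l / E (Sum.inl l) ^ 2 := by
    constructor
    · intro h
      funext l
      have hl := h l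
      field_simp [hEL l]
      linarith
    · intro h l
      rw [h]
      field_simp [hEL l]
      ring
  rw [hsplit, hshunt]
  have hcong : b = (fun l => Q l / E (Sum.inl l) ^ 2) →
      W.closedLoop (ziLoad b 0) E = W.closedLoop (zipLoad 0 0 Q) E := fun h2 =>
    closedLoop_congr fun l => by
      rw [h2]
      simp only [ziLoad, zipLoad, Pi.zero_apply, zero_mul, add_zero, zero_add]
      exact div_mul_cancel₀ _ (pow_ne_zero 2 (hEL l))
  constructor
  · rintro ⟨h1, h2⟩
    refine ⟨?_, h2⟩
    show W.closedLoop (zipLoad 0 0 Q) E = 0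
    rw [← hcong h2]; exact h1
  · rintro ⟨h1, h2⟩
    refine ⟨?_, h2⟩
    rw [hcong h2]; exact h1

variable {W} in
/-- **With Theorem 3.1**: for positive voltages and `B_II + K_I` invertible, `(E, b)` is an equilibrium
of (3.3), (3.16) iff `E_L` solves the reduced power flow equation (3.7) with constant-power loads,
`E_I = W₂(E_L, E_I*)` (3.8) and `b = [E_L]⁻²Q_L` (3.18).
[cite: SimpsonporcoDorflerBullo2017, §3.3 Theorem 3.5 eqs. (3.17)–(3.18) with Theorem 3.1 and Appendix A (p0019 L68–L69)] -/
theorem isDSEquilibrium_iff_reducedPowerFlow (hU : IsUnit W.BIIK.det) (Q : Fin n → ℝ)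
    {E : Fin n ⊕ Fin m → ℝ} (hE : ∀ k, 0 < E k) (b : Fin n → ℝ) :
    W.IsDSEquilibrium Q E b ↔
      W.ReducedPowerFlow (zipLoad 0 0 Q) (fun l => E (Sum.inl l)) ∧
        (fun i => E (Sum.inr i)) = W.invVoltage (fun l => E (Sum.inl l)) ∧
        b = fun l => Q l / E (Sum.inl l) ^ 2 := by
  rw [isDSEquilibrium_iff Q (fun l => (hE (Sum.inl l)).ne') b,
    isEquilibrium_iff_reducedPowerFlow hU _ (fun i => hE (Sum.inr i)), and_assoc]

/-! ## §2 The equilibrium for small `Q_L`: Theorem 3.4 at `b_shunt = I_shunt = 0` -/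

variable {W} in
/-- At `b_shunt = I_shunt = 0` the ZI solution is the open-circuit load voltage vector:
`E_L^{ZI} = B_red⁻¹(B_redE_L*) = E_L*`. [cite: SimpsonporcoDorflerBullo2017, §3.3 after Theorem 3.3 («in the case of open-circuit operation … `E_L^{ZI} = E_L^*`», p0011 L48–L50) and Theorem 3.5 (`[E_L^*]` in (3.17))] -/
theorem ziVoltage_zero_zero (hred : IsUnit W.Bred.det) : W.ziVoltage 0 0 = W.ELstar := by
  rw [ziVoltage, diagonal_zero', add_zero, sub_zero, ← Bred_mulVec_ELstar hred, mulVec_mulVec,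
    nonsing_inv_mul _ hred, one_mulVec]

variable {W} in
/-- At `b_shunt = I_shunt = 0` the short-circuit capacity matrix is `Q_sc = [E_L*]B_red[E_L*]`.
[cite: SimpsonporcoDorflerBullo2017, §3.3 Theorem 3.5 («where `Q_sc = [E_L^*]B_red[E_L^*]`»)] -/
theorem Qsc_zero_zero (hred : IsUnit W.Bred.det) :
    W.Qsc 0 0 = diagonal W.ELstar * W.Bred * diagonal W.ELstar := by
  rw [Qsc, ziVoltage_zero_zero hred, diagonal_zero', add_zero]

/-- **`E_L^{DS}(Q_L)`** — the high-voltage solution of (3.7) with constant-power loads (Theorem 3.4's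
solution map at `b_shunt = I_shunt = 0`). [cite: SimpsonporcoDorflerBullo2017, §3.3 Theorem 3.5 eq. (3.17)] -/
def dsVoltage (Q : Fin n → ℝ) : Fin n → ℝ := W.zipVoltage 0 0 Q

/-- **`b^{DS}(Q_L) = [E_L^{DS}]⁻²Q_L`**. [cite: SimpsonporcoDorflerBullo2017, §3.3 Theorem 3.5 eq. (3.18)] -/
def dsShunt (Q : Fin n → ℝ) : Fin n → ℝ := fun l => Q l / W.dsVoltage Q l ^ 2

/-- **`(E_L^{DS}, E_I^{DS})`** with `E_I^{DS} = W₂(E_L^{DS}, E_I*)`. [cite: SimpsonporcoDorflerBullo2017, §3.3 Theorem 3.5 («the corresponding equilibrium point `(E_L^{DS}, E_I^{DS}, b^{DS})`») with Theorem 3.1 eq. (3.8)] -/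
def dsState (Q : Fin n → ℝ) : Fin n ⊕ Fin m → ℝ := W.liftState (W.dsVoltage Q)

variable {W} in
/-- `b^{DS} < 0` iff the demand is inductive, at a positive solution. [cite: SimpsonporcoDorflerBullo2017, §3.3 Theorem 3.5 («`(E_L^{DS}, b^{DS}) ∈ ℝ^n_{>0} × ℝ^n_{<0}`» for «`Q_i < 0`»)] -/
theorem dsShunt_neg_iff {Q : Fin n → ℝ} {l : Fin n} (hE : W.dsVoltage Q l ≠ 0) :
    W.dsShunt Q l < 0 ↔ Q l < 0 := by
  rw [dsShunt, div_neg_iff]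
  have hsq : 0 < W.dsVoltage Q l ^ 2 := by positivity
  constructor
  · rintro (⟨-, h⟩ | ⟨h, -⟩)
    · exact absurd h (not_lt.2 hsq.le)
    · exact h
  · exact fun h => Or.inr ⟨h, hsq⟩

variable {W} in
/-- **Theorem 3.5, the equilibrium** («the approximate steady-state load voltages `E_L^{DS}` are given as
in Theorem 3.4 with `b_shunt = 0` and `I_shunt = 0`, yielding the stated equilibrium»).  Hypotheses:
`B` symmetric with nonnegative off-diagonal entries and zero row sums, `−(B + blkdiag(0, K_I)) ≻ 0`,
`K_i ≤ 0`, `E_i* > 0` (Proposition 7.2's data) and Theorem 3.3 (ii) at `I_shunt = 0`: `B_redE_L* < 0`.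
Then for ALL SUFFICIENTLY SMALL `Q_L`: `(E_L^{DS}, E_I^{DS}) ∈ ℝ^{n+m}_{>0}`; `(E^{DS}, b^{DS})` IS an
equilibrium of (3.3), (3.16); `b^{DS}_l < 0 ⟺ Q_l < 0`; near `(Q_L, E_L) = (0, E_L*)` the equilibria with
positive voltages are exactly `(E^{DS}(Q_L), b^{DS}(Q_L))` (local uniqueness); and
`E_L^{DS} = [E_L*](𝟙 − Q_sc⁻¹Q_L + ε)` with `‖ε‖ ≤ C‖Q_sc⁻¹Q_L‖²`, `Q_sc = [E_L*]B_red[E_L*]`.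
[cite: SimpsonporcoDorflerBullo2017, §3.3 Theorem 3.5 (p0012 L28–L38) with Appendix A (p0019 L68–L69) and Theorem 3.4] -/
theorem theorem_3_5_equilibrium (hB : W.B.IsSymm) (hoff : ∀ k k', k ≠ k' → 0 ≤ W.B k k')
    (hrowB : ∀ k, ∑ k', W.B k k' = 0) (hM : (-(W.B + Matrix.fromBlocks 0 0 0 (diagonal W.K))).PosDef)
    (hK : ∀ i, W.K i ≤ 0) (hEs : ∀ i, 0 < W.Estar i) (hI : ∀ l, W.redSource l < 0) :
    W.dsVoltage 0 = W.ELstar ∧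
      W.Qsc 0 0 = diagonal W.ELstar * W.Bred * diagonal W.ELstar ∧
      (∀ᶠ Q in 𝓝 (0 : Fin n → ℝ),
        (∀ k, 0 < W.dsState Q k) ∧
        W.IsDSEquilibrium Q (W.dsState Q) (W.dsShunt Q) ∧
        (∀ l, W.dsShunt Q l < 0 ↔ Q l < 0)) ∧
      (∀ᶠ p in 𝓝 ((0 : Fin n → ℝ), W.ELstar), ∀ (EI : Fin m → ℝ) (b : Fin n → ℝ),
        (∀ l, 0 < p.2 l) → (∀ i, 0 < EI i) →
          (W.IsDSEquilibrium p.1 (Sum.elim p.2 EI) b ↔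
            p.2 = W.dsVoltage p.1 ∧ EI = W.invVoltage (W.dsVoltage p.1) ∧ b = W.dsShunt p.1)) ∧
      (∀ Q, W.dsVoltage Q = fun l => W.ELstar l
        * (1 - ((W.Qsc 0 0)⁻¹ *ᵥ Q) l + W.zipError 0 0 Q (W.dsVoltage Q) l)) ∧
      ∃ C : ℝ, 0 ≤ C ∧ ∀ᶠ Q in 𝓝 (0 : Fin n → ℝ),
        ‖W.zipError 0 0 Q (W.dsVoltage Q)‖ ≤ C * ‖(W.Qsc 0 0)⁻¹ *ᵥ Q‖ ^ 2 := by
  obtain ⟨⟨hred, hZ0⟩, -, ⟨hW2nn, hW2one⟩, -⟩ := proposition_7_2 hB hoff hrowB hM hK hEs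
  have hUred : IsUnit W.Bred.det := isUnit_det_of_posDef_neg₃ hred
  have hII := posDef_neg_BIIK_of_posDef_aug hM
  have hU : IsUnit W.BIIK.det := isUnit_BIIK_det_of_posDef hII
  have hA : (-(W.Bred + diagonal (0 : Fin n → ℝ))).PosDef := by rwa [diagonal_zero', add_zero]
  have hZ : IsZMatrix (-(W.Bred + diagonal (0 : Fin n → ℝ))) := by rwa [diagonal_zero', add_zero]
  have hI' : ∀ l, W.redSource l < (0 : Fin n → ℝ) l := fun l => hI l
  obtain ⟨h0, -, hev, hiff, hexp, hC⟩ := W.theorem_3_4_zipLoads hA hZ hI'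
  have hEstar : W.ziVoltage 0 0 = W.ELstar := ziVoltage_zero_zero hUred
  refine ⟨?_, Qsc_zero_zero hUred, ?_, ?_, ?_, ?_⟩
  · rw [dsVoltage, h0, hEstar]
  · filter_upwards [hev] with Q hQ
    obtain ⟨hpos, hR, -⟩ := hQ
    have hEI : ∀ i, 0 < W.invVoltage (W.dsVoltage Q) i := fun i =>
      invVoltage_pos hW2nn hW2one hEs hpos i
    have hall : ∀ k, 0 < W.dsState Q k := by
      intro k; cases k with
      | inl l => exact hpos l
      | inr i => exact hEI i
    refine ⟨hall, ?_, fun l => dsShunt_neg_iff (hpos l).ne'⟩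
    exact (isDSEquilibrium_iff_reducedPowerFlow hU Q hall _).2 ⟨hR, rfl, rfl⟩
  · rw [← hEstar]
    filter_upwards [hiff] with p hp EI b hpL hpI
    have hall : ∀ k, 0 < Sum.elim p.2 EI k := by
      intro k; cases k with
      | inl l => exact hpL l
      | inr i => exact hpI i
    rw [isDSEquilibrium_iff_reducedPowerFlow hU p.1 hall b]
    simp only [Sum.elim_inl, Sum.elim_inr]
    rw [hp]
    have hds : W.dsVoltage p.1 = W.zipVoltage 0 0 p.1 := rfl
    have hsh : W.dsShunt p.1 = fun l => p.1 l / W.zipVoltage 0 0 p.1 l ^ 2 := rfl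
    rw [hds, hsh]
    constructor
    · rintro ⟨h1, h2, h3⟩
      refine ⟨h1.symm, ?_, ?_⟩
      · rw [h1]; exact h2
      · rw [h1]; exact h3
    · rintro ⟨h1, h2, h3⟩
      refine ⟨h1.symm, ?_, ?_⟩
      · rw [← h1] at h2; exact h2
      · rw [← h1] at h3; exact h3
  · intro Q
    rw [← hEstar]
    exact hexp Q
  · exact hC

/-! ## §3 The linearised extended DAE at an equilibrium `(E_L, W₂(E_L, E_I*), b)` and its symmetrised
pencil `𝒥 = Λ𝓜` — «the proof methodology of Theorem 3.2 applied to the extended dynamics» -/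

section Linearisation

variable (EL b : Fin n → ℝ)

/-- The load-model derivative inside `J`: `∂(b_lE_l²)/∂E_l = 2b_lE_l`.
[cite: SimpsonporcoDorflerBullo2017, proof of Theorem 3.2 eq. (3.11′) (`D_ll = dQ_l/dE_l`) with the load model of (3.16)] -/
def dsDQ : Fin n → ℝ := fun l => 2 * b l * EL l

/-- **Algebraic block** `𝒥_LL = J_LL` (load rows w.r.t. `E_L`). [cite: SimpsonporcoDorflerBullo2017, proof of Theorem 3.2 (block `J_LL`) and Appendix A proof of Theorem 3.5 («applying the proof methodologies of Theorems 3.2 and 3.4 to the extended dynamics», p0019 L70–L71)] -/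
def dsJLL : Matrix (Fin n) (Fin n) ℝ := W.jacLL (dsDQ EL b) (W.liftState EL)

/-- **`𝒥_Ld = [J_LI, ∂(load rows)/∂b] = [J_LI, [E_L²]]`**. [cite: SimpsonporcoDorflerBullo2017, Appendix A proof of Theorem 3.5 (p0019 L70–L71) with eq. (3.16)] -/
def dsJLd : Matrix (Fin n) (Fin m ⊕ Fin n) ℝ :=
  Matrix.fromCols (W.jacLI (dsDQ EL b) (W.liftState EL)) (diagonal fun l => EL l ^ 2)

/-- **`𝒥_dL = [J_IL; ∂(shunt rows)/∂E_L] = [J_IL; −2[E_Lb]]`**. [cite: SimpsonporcoDorflerBullo2017, Appendix A proof of Theorem 3.5 (p0019 L70–L71) with eq. (3.16)] -/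
def dsJdL : Matrix (Fin m ⊕ Fin n) (Fin n) ℝ :=
  Matrix.fromRows (W.jacIL (dsDQ EL b) (W.liftState EL)) (diagonal fun l => -(2 * EL l * b l))

/-- **`𝒥_dd = [J_II, 0; 0, ∂(shunt rows)/∂b] = [J_II, 0; 0, −[E_L²]]`**. [cite: SimpsonporcoDorflerBullo2017, Appendix A proof of Theorem 3.5 (p0019 L70–L71) with eq. (3.16)] -/
def dsJdd : Matrix (Fin m ⊕ Fin n) (Fin m ⊕ Fin n) ℝ :=
  Matrix.fromBlocks (W.jacII (dsDQ EL b) (W.liftState EL)) 0 0 (-diagonal fun l => EL l ^ 2)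

/-- **The reduced matrix of the linearised extended DAE**: linearise (3.3), (3.16) at the equilibrium
(`0 = 𝒥_LLx_L + 𝒥_Ldx_d`, `diag(τ, T)ẋ_d = 𝒥_dLx_L + 𝒥_ddx_d`, `x_d = (x_I, x_b)`), eliminate the
algebraic variables: `ẋ_d = diag(τ, T)⁻¹(𝒥_dd − 𝒥_dL𝒥_LL⁻¹𝒥_Ld)x_d`.
[cite: SimpsonporcoDorflerBullo2017, proof of Theorem 3.2 («linearizing the differential algebraic system, eliminating the algebraic equations from the system matrix, and checking that the resulting reduced matrix is Hurwitz») applied per Appendix A (p0019 L70–L71) to (3.3), (3.16); Riaza2008, §3.1] -/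
def dsRedStateMatrix (T : Fin n → ℝ) : Matrix (Fin m ⊕ Fin n) (Fin m ⊕ Fin n) ℝ :=
  diagonal (Sum.elim (fun i => (W.τ i)⁻¹) fun l => (T l)⁻¹) *
    (W.dsJdd EL b - W.dsJdL EL b * (W.dsJLL EL b)⁻¹ * W.dsJLd EL b)

/-- The off-diagonal block of the symmetrised pencil: `𝓜_Ld = [B_LI, [E_L]]`.
[cite: SimpsonporcoDorflerBullo2017, proof of Theorem 3.2 («`M = Mᵀ ≜ B + [E]⁻¹([BE] + D)`», block form) applied to (3.3), (3.16)] -/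
def dsMLd : Matrix (Fin n) (Fin m ⊕ Fin n) ℝ := Matrix.fromCols W.BLI (diagonal EL)

/-- The differential block of the symmetrised pencil: `𝓜_dd = [B_II + K_I, 0; 0, [E_L²/(2b)]]` (the shunt
rows scaled by `[−2b]⁻¹`). [cite: SimpsonporcoDorflerBullo2017, proof of Theorem 3.2 (symmetrisation) applied to (3.3), (3.16)] -/
def dsMdd : Matrix (Fin m ⊕ Fin n) (Fin m ⊕ Fin n) ℝ :=
  Matrix.fromBlocks W.BIIK 0 0 (diagonal fun l => EL l ^ 2 / (2 * b l))

/-- **The symmetrised pencil** `𝓜 = [M₁₁ 𝓜_Ld; 𝓜_Ldᴴ 𝓜_dd]` with `M₁₁ = symJacLL` at `∂Q/∂E = 2bE`.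
[cite: SimpsonporcoDorflerBullo2017, proof of Theorem 3.2 («we left-multiply through by `[E]⁻¹` and formulate the previous GEP as the symmetric GEP `Mv = λ[E]⁻¹τv`») applied per Appendix A (p0019 L70–L71) to (3.3), (3.16)] -/
def dsSymJac : Matrix (Fin n ⊕ (Fin m ⊕ Fin n)) (Fin n ⊕ (Fin m ⊕ Fin n)) ℝ :=
  Matrix.fromBlocks (W.symJacLL (dsDQ EL b) EL) (W.dsMLd EL) (W.dsMLd EL)ᴴ (W.dsMdd EL b)

/-- The reduced symmetric matrix `𝓜_red = 𝓜_dd − 𝓜_LdᴴM₁₁⁻¹𝓜_Ld`.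
[cite: SimpsonporcoDorflerBullo2017, proof of Theorem 3.2 («`M_red = M_redᵀ ≜ M_II − M_IL M_LL⁻¹ M_LI`») applied to (3.3), (3.16)] -/
def dsMred : Matrix (Fin m ⊕ Fin n) (Fin m ⊕ Fin n) ℝ :=
  W.dsMdd EL b - (W.dsMLd EL)ᴴ * (W.symJacLL (dsDQ EL b) EL)⁻¹ * W.dsMLd EL

/-- The row scaling of the differential rows: `Λ_d = diag([E_I], [−2b])`.
[cite: SimpsonporcoDorflerBullo2017, proof of Theorem 3.2 («Since `E` is strictly positive, we left-multiply through by `[E]⁻¹`») applied to (3.3), (3.16)] -/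
def dsScale : Matrix (Fin m ⊕ Fin n) (Fin m ⊕ Fin n) ℝ :=
  diagonal (Sum.elim (W.invVoltage EL) fun l => -(2 * b l))

variable {W EL b}

/-- `𝓜_Ldᴴ = [B_IL; [E_L]]` for symmetric `B`. [cite: SimpsonporcoDorflerBullo2017, §7 Lemma 7.1 (i)] -/
theorem dsMLd_conjTranspose (hB : W.B.IsSymm) :
    (W.dsMLd EL)ᴴ = Matrix.fromRows W.BIL (diagonal EL) := by
  rw [dsMLd, conjTranspose_fromCols_eq_fromRows_conjTranspose, BLI_conjTranspose hB,
    conjTranspose_eq_transpose_of_trivial, diagonal_transpose]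

/-- **`𝒥 = Λ𝓜`, block by block** at `(E_L, W₂(E_L, E_I*), b)` with nonvanishing voltages and `b_l ≠ 0`:
`𝒥_LL = [E_L]M₁₁`, `𝒥_Ld = [E_L]𝓜_Ld`, `𝒥_dL = Λ_d𝓜_Ldᴴ`, `𝒥_dd = Λ_d𝓜_dd`.
[cite: SimpsonporcoDorflerBullo2017, proof of Theorem 3.2 («`J = [E]M`», block partitioning) applied per Appendix A (p0019 L70–L71) to (3.3), (3.16)] -/
theorem dsJac_eq_scale_mul (hB : W.B.IsSymm) (hU : IsUnit W.BIIK.det) (hEL : ∀ l, EL l ≠ 0)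
    (hEI : ∀ i, W.invVoltage EL i ≠ 0) (hb : ∀ l, b l ≠ 0) :
    W.dsJLL EL b = diagonal EL * W.symJacLL (dsDQ EL b) EL ∧
      W.dsJLd EL b = diagonal EL * W.dsMLd EL ∧
      W.dsJdL EL b = W.dsScale EL b * (W.dsMLd EL)ᴴ ∧
      W.dsJdd EL b = W.dsScale EL b * W.dsMdd EL b := by
  obtain ⟨h11, h12, h21, h22⟩ := jac_liftState_blocks hU (dsDQ EL b) hEL hEI
  refine ⟨?_, ?_, ?_, ?_⟩
  · rw [dsJLL, h11]
  · rw [dsJLd, h12, dsMLd, mul_fromCols, diagonal_mul_diagonal]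
    congr 2
    funext l; ring
  · rw [dsJdL, h21, dsMLd_conjTranspose hB, dsScale, ← fromBlocks_diagonal, fromBlocks_mul_fromRows,
      Matrix.zero_mul, Matrix.zero_mul, add_zero, zero_add, diagonal_mul_diagonal]
    congr 2
    funext l; ring
  · rw [dsJdd, h22, dsScale, dsMdd, ← fromBlocks_diagonal, fromBlocks_multiply]
    simp only [Matrix.mul_zero, Matrix.zero_mul, add_zero, zero_add, diagonal_mul_diagonal]
    congr 2
    rw [diagonal_neg]
    congr 1
    funext l
    field_simp [hb l]

/-- `𝓜_dd⁻¹ = [(B_II + K_I)⁻¹, 0; 0, [2b/E_L²]]`. [folklore] -/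
private theorem dsMdd_inv (hU : IsUnit W.BIIK.det) (hEL : ∀ l, EL l ≠ 0) (hb : ∀ l, b l ≠ 0) :
    (W.dsMdd EL b)⁻¹ = Matrix.fromBlocks W.BIIK⁻¹ 0 0 (diagonal fun l => 2 * b l / EL l ^ 2) := by
  refine inv_eq_right_inv ?_
  rw [dsMdd, fromBlocks_multiply]
  simp only [Matrix.mul_zero, Matrix.zero_mul, add_zero, zero_add, mul_nonsing_inv _ hU,
    diagonal_mul_diagonal]
  rw [← fromBlocks_one]
  congr 1
  rw [← diagonal_one]
  congr 1
  funext l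
  field_simp [hb l, hEL l]

/-- **The Schur complement of `𝓜` with respect to its differential block is `[E_L]⁻¹J_red` at
`∂Q/∂E = 0`**: `M₁₁ − 𝓜_Ld𝓜_dd⁻¹𝓜_Ldᴴ = (M₁₁ − B_LI(B_II + K_I)⁻¹B_IL) − 2[b] = symJacRed 0 E_L`
(the completed square in the shunt variables removes the load-model derivative `2[b]`).
[cite: SimpsonporcoDorflerBullo2017, proof of Theorem 3.2 (Schur complement (3.12′) «is exactly `−[E_L]⁻¹` times the Jacobian (3.9)») applied per Appendix A (p0019 L70–L71) to (3.3), (3.16)] -/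
theorem dsSchur_eq_symJacRed_zero (hB : W.B.IsSymm) (hU : IsUnit W.BIIK.det) (hEL : ∀ l, EL l ≠ 0)
    (hb : ∀ l, b l ≠ 0) :
    W.symJacLL (dsDQ EL b) EL - W.dsMLd EL * (W.dsMdd EL b)⁻¹ * (W.dsMLd EL)ᴴ
      = W.symJacRed 0 EL := by
  rw [dsMdd_inv hU hEL hb, dsMLd_conjTranspose hB, dsMLd, fromCols_mul_fromBlocks,
    Matrix.mul_zero, Matrix.mul_zero, add_zero, zero_add, fromCols_mul_fromRows, diagonal_mul_diagonal,
    diagonal_mul_diagonal]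
  have h2b : (fun l => EL l * (2 * b l / EL l ^ 2) * EL l) = fun l => 2 * b l := by
    funext l; field_simp [hEL l]
  rw [h2b, ← sub_sub, symJacLL_sub]
  rw [symJacRed, symJacRed]
  ext i j
  simp only [Matrix.sub_apply, Matrix.add_apply, diagonal_apply, dsDQ, Pi.zero_apply, zero_div]
  split_ifs with h
  · subst h; field_simp [hEL i]; ring
  · ring

/-- **Schur-complement criterion, `₂₂` form, definite version** (restated privately):
`D ≻ 0` and `A − BD⁻¹Bᴴ ≻ 0` give `[A B; Bᴴ D] ≻ 0`. [folklore] -/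
private theorem posDef_fromBlocks_of_schur₂₂₃ {p q : Type*} [Fintype p] [Fintype q] [DecidableEq q]
    {A : Matrix p p ℝ} {B : Matrix p q ℝ} {D : Matrix q q ℝ} (hD : D.PosDef)
    (hS : (A - B * D⁻¹ * Bᴴ).PosDef) : (Matrix.fromBlocks A B Bᴴ D).PosDef := by
  classical
  obtain ⟨hInv⟩ := hD.isUnit.nonempty_invertible
  rw [Matrix.posDef_iff_dotProduct_mulVec]
  refine ⟨(IsHermitian.fromBlocks₂₂ A B hD.1).2 hS.1, fun v hv => ?_⟩
  rw [← Sum.elim_comp_inl_inr v, Matrix.dotProduct_mulVec,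
    Matrix.schur_complement_eq₂₂ A B _ _ hD.1, ← Matrix.dotProduct_mulVec, ← Matrix.dotProduct_mulVec]
  set x : p → ℝ := v ∘ Sum.inl with hx
  set y : q → ℝ := v ∘ Sum.inr with hy
  set z : q → ℝ := (D⁻¹ * Bᴴ) *ᵥ x + y with hz
  have hDz : 0 ≤ star z ⬝ᵥ (D *ᵥ z) := by
    simpa using hD.posSemidef.dotProduct_mulVec_nonneg z
  by_cases hx0 : x = 0
  · have hy0 : y ≠ 0 := by
      intro hy0
      apply hv
      rw [← Sum.elim_comp_inl_inr v]
      change Sum.elim x y = 0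
      rw [hx0, hy0]
      funext k; cases k <;> rfl
    have hz' : z = y := by rw [hz, hx0, Matrix.mulVec_zero, zero_add]
    have hSx : star x ⬝ᵥ ((A - B * D⁻¹ * Bᴴ) *ᵥ x) = 0 := by rw [hx0]; simp
    rw [hSx, add_zero, hz']
    exact hD.dotProduct_mulVec_pos hy0
  · exact add_pos_of_nonneg_of_pos hDz (hS.dotProduct_mulVec_pos hx0)

/-- **Schur complement of a positive definite block matrix, `₁₁` form** (restated privately):
`[A B; Bᴴ D] ≻ 0` with `A ≻ 0` gives `D − BᴴA⁻¹B ≻ 0`. [folklore] -/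
private theorem posDef_schur₁₁_of_posDef_fromBlocks₃ {p q : Type*} [Fintype p] [Fintype q]
    [DecidableEq p] {A : Matrix p p ℝ} {B : Matrix p q ℝ} {D : Matrix q q ℝ} (hA : A.PosDef)
    (hM : (Matrix.fromBlocks A B Bᴴ D).PosDef) : (D - Bᴴ * A⁻¹ * B).PosDef := by
  classical
  obtain ⟨hInv⟩ := hA.isUnit.nonempty_invertible
  rw [Matrix.posDef_iff_dotProduct_mulVec]
  refine ⟨(IsHermitian.fromBlocks₁₁ B D hA.1).1 hM.1, fun y hy => ?_⟩
  set x : p → ℝ := -((A⁻¹ * B) *ᵥ y) with hx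
  have hv : Sum.elim x y ≠ 0 := by
    intro h0
    apply hy
    funext i
    exact congrFun h0 (Sum.inr i)
  have hform := (Matrix.posDef_iff_dotProduct_mulVec.1 hM).2 hv
  rw [Matrix.dotProduct_mulVec, Matrix.schur_complement_eq₁₁ B D x y hA.1] at hform
  have hzero : x + (A⁻¹ * B) *ᵥ y = 0 := by rw [hx]; abel
  rw [hzero, star_zero, Matrix.zero_vecMul, zero_dotProduct, zero_add,
    ← Matrix.dotProduct_mulVec] at hform
  exact hform

/-- **`−𝓜 ≻ 0`** at an equilibrium with `E_L^{·} ≠ 0`, INDUCTIVE shunts `b < 0`, `B` symmetric,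
`−(B_II + K_I) ≻ 0`, whenever `−[E_L]⁻¹J_red ≻ 0` at `∂Q/∂E = 0` — Theorem 3.4's certificate
`−B_red + [E_L]⁻²[Q_L] ≻ 0` at a constant-power solution.
[cite: SimpsonporcoDorflerBullo2017, proof of Theorem 3.2 («`−M` will be positive definite if and only if the Schur complement … is also positive definite») applied per Appendix A (p0019 L70–L71) to (3.3), (3.16)] -/
theorem posDef_neg_dsSymJac (hB : W.B.IsSymm) (hII : (-W.BIIK).PosDef) (hEL : ∀ l, EL l ≠ 0)
    (hb : ∀ l, b l < 0) (hS : (-W.symJacRed 0 EL).PosDef) : (-W.dsSymJac EL b).PosDef := by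
  classical
  have hU : IsUnit W.BIIK.det := isUnit_BIIK_det_of_posDef hII
  have hb' : ∀ l, b l ≠ 0 := fun l => (hb l).ne
  -- the differential block `−𝓜_dd ≻ 0`
  have hDq : (-(diagonal fun l => EL l ^ 2 / (2 * b l))).PosDef := by
    rw [diagonal_neg, posDef_diagonal_iff]
    intro l
    have h0 : EL l ≠ 0 := hEL l
    have h1 : 0 < EL l ^ 2 := by positivity
    have h2 : 2 * b l < 0 := by linarith [hb l]
    simpa using div_neg_of_pos_of_neg h1 h2
  have hD : (-W.dsMdd EL b).PosDef := by
    rw [dsMdd, fromBlocks_neg, neg_zero, neg_zero]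
    have h := posDef_fromBlocks_of_schur₂₂₃ (A := -W.BIIK) (B := (0 : Matrix (Fin m) (Fin n) ℝ)) hDq
      (by simpa using hII)
    rwa [conjTranspose_zero] at h
  have hUD : IsUnit (W.dsMdd EL b).det := isUnit_det_of_posDef_neg₃ hD
  -- the Schur complement of `−𝓜` w.r.t. `−𝓜_dd` is `−symJacRed 0 E_L`
  have hSchur : -W.symJacLL (dsDQ EL b) EL - -W.dsMLd EL * (-W.dsMdd EL b)⁻¹ * (-W.dsMLd EL)ᴴ
      = -W.symJacRed 0 EL := by
    rw [← dsSchur_eq_symJacRed_zero hB hU hEL hb', inv_neg_eq₃ hUD, conjTranspose_neg]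
    simp only [Matrix.neg_mul, Matrix.mul_neg, neg_neg]
    abel
  rw [dsSymJac, fromBlocks_neg]
  have h := posDef_fromBlocks_of_schur₂₂₃ (A := -W.symJacLL (dsDQ EL b) EL) (B := -W.dsMLd EL) hD
    (by rw [hSchur]; exact hS)
  rwa [conjTranspose_neg] at h

/-- Hence `−M₁₁ ≻ 0` (a principal block), so the algebraic equations CAN be eliminated:
`𝒥_LL = [E_L]M₁₁` is invertible — index one. [cite: SimpsonporcoDorflerBullo2017, proof of Theorem 3.2 («eliminating the algebraic equations»); Riaza2008, §3.1 (index one)] -/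
theorem posDef_neg_dsSymJacLL (hB : W.B.IsSymm) (hII : (-W.BIIK).PosDef) (hEL : ∀ l, EL l ≠ 0)
    (hb : ∀ l, b l < 0) (hS : (-W.symJacRed 0 EL).PosDef) :
    (-W.symJacLL (dsDQ EL b) EL).PosDef := by
  have hM := posDef_neg_dsSymJac hB hII hEL hb hS
  have h := hM.submatrix Sum.inl_injective
  have hsub : (-W.dsSymJac EL b).submatrix Sum.inl Sum.inl = -W.symJacLL (dsDQ EL b) EL := by
    ext l l'
    simp [dsSymJac, Matrix.fromBlocks_apply₁₁]
  rwa [hsub] at h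

/-- **`−𝓜_red ≻ 0`** (Schur complement of `−𝓜 ≻ 0` with respect to the algebraic block).
[cite: SimpsonporcoDorflerBullo2017, proof of Theorem 3.2 («We now show indirectly that `−M_red` is positive definite») applied per Appendix A (p0019 L70–L71) to (3.3), (3.16)] -/
theorem posDef_neg_dsMred (hB : W.B.IsSymm) (hII : (-W.BIIK).PosDef) (hEL : ∀ l, EL l ≠ 0)
    (hb : ∀ l, b l < 0) (hS : (-W.symJacRed 0 EL).PosDef) : (-W.dsMred EL b).PosDef := by
  classical
  have hM := posDef_neg_dsSymJac hB hII hEL hb hS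
  have hLL := posDef_neg_dsSymJacLL hB hII hEL hb hS
  have hULL : IsUnit (W.symJacLL (dsDQ EL b) EL).det := isUnit_det_of_posDef_neg₃ hLL
  rw [dsSymJac, fromBlocks_neg, ← conjTranspose_neg] at hM
  have h := posDef_schur₁₁_of_posDef_fromBlocks₃ hLL hM
  have hform : -W.dsMdd EL b - (-W.dsMLd EL)ᴴ * (-W.symJacLL (dsDQ EL b) EL)⁻¹ * -W.dsMLd EL
      = -W.dsMred EL b := by
    rw [conjTranspose_neg, inv_neg_eq₃ hULL, dsMred]
    simp only [Matrix.neg_mul, Matrix.mul_neg, neg_neg]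
    abel
  rwa [hform] at h

/-- **The reduced matrix in symmetric form**: `diag(τ, T)⁻¹(𝒥_dd − 𝒥_dL𝒥_LL⁻¹𝒥_Ld) =
diag(E_I/τ, −2b/T)·𝓜_red` at `(E_L, W₂(E_L, E_I*), b)` (nonvanishing voltages, `b_l ≠ 0`, `M₁₁`
invertible). [cite: SimpsonporcoDorflerBullo2017, proof of Theorem 3.2 («we arrive at a reduced GEP `M_red v_I = λ[E_I]⁻¹τ_I v_I`») applied per Appendix A (p0019 L70–L71) to (3.3), (3.16)] -/
theorem dsRedStateMatrix_eq (hB : W.B.IsSymm) (hU : IsUnit W.BIIK.det) (hEL : ∀ l, EL l ≠ 0)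
    (hEI : ∀ i, W.invVoltage EL i ≠ 0) (hb : ∀ l, b l ≠ 0) (T : Fin n → ℝ) :
    W.dsRedStateMatrix EL b T
      = diagonal (Sum.elim (fun i => W.invVoltage EL i / W.τ i) fun l => -(2 * b l) / T l)
          * W.dsMred EL b := by
  obtain ⟨h11, h12, h21, h22⟩ := dsJac_eq_scale_mul hB hU hEL hEI hb
  have hdiagL : IsUnit (diagonal EL).det := by
    rw [det_diagonal, isUnit_iff_ne_zero]
    exact Finset.prod_ne_zero_iff.2 fun l _ => hEL l
  rw [dsRedStateMatrix, h11, h12, h21, h22, Matrix.mul_inv_rev]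
  have hmid : W.dsScale EL b * (W.dsMLd EL)ᴴ * ((W.symJacLL (dsDQ EL b) EL)⁻¹ * (diagonal EL)⁻¹)
        * (diagonal EL * W.dsMLd EL)
      = W.dsScale EL b * ((W.dsMLd EL)ᴴ * (W.symJacLL (dsDQ EL b) EL)⁻¹ * W.dsMLd EL) := by
    simp only [Matrix.mul_assoc]
    rw [← Matrix.mul_assoc (diagonal EL)⁻¹, Matrix.nonsing_inv_mul _ hdiagL, Matrix.one_mul]
  rw [hmid, ← Matrix.mul_sub, ← Matrix.mul_assoc, dsScale, diagonal_mul_diagonal, dsMred]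
  congr 2
  funext k
  cases k with
  | inl i => simp [div_eq_inv_mul]
  | inr l => simp [div_eq_inv_mul]

/-- **The reduced matrix of the linearised extended DAE is Hurwitz, and the algebraic block is invertible**,
at an equilibrium `(E_L, W₂(E_L, E_I*), b)` with `E_L > 0`, `E_I > 0`, INDUCTIVE shunts `b < 0`, `B`
symmetric, `−(B_II + K_I) ≻ 0`, `τ_i, T_l > 0`, under Theorem 3.4's certificate in the form
`−[E_L]⁻¹J_red(∂Q/∂E = 0) ≻ 0` («a tedious but straightforward calculation shows that applying the
proof methodologies of Theorems 3.2 and 3.4 to the extended dynamics (3.3), (3.16) yields local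
exponential stability» — at the reduced-matrix tier: `diag(E_I/τ, −2b/T)·𝓜_red` with `−𝓜_red ≻ 0`,
Horn–Johnson Thm. 7.6.1 (a)). [cite: SimpsonporcoDorflerBullo2017, §3.3 Theorem 3.5 («locally exponentially stable») and Appendix A (p0019 L70–L71); HornJohnson2013, §7.6 Thm. 7.6.1 (a)] -/
theorem dsRedStateMatrix_isHurwitz (hB : W.B.IsSymm) (hII : (-W.BIIK).PosDef) (hτ : ∀ i, 0 < W.τ i)
    {T : Fin n → ℝ} (hT : ∀ l, 0 < T l) (hEL : ∀ l, 0 < EL l) (hEI : ∀ i, 0 < W.invVoltage EL i)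
    (hb : ∀ l, b l < 0) (hS : (-W.symJacRed 0 EL).PosDef) :
    IsHurwitz (W.dsRedStateMatrix EL b T) ∧ IsUnit (W.dsJLL EL b).det := by
  have hU : IsUnit W.BIIK.det := isUnit_BIIK_det_of_posDef hII
  have hEL' : ∀ l, EL l ≠ 0 := fun l => (hEL l).ne'
  have hEI' : ∀ i, W.invVoltage EL i ≠ 0 := fun i => (hEI i).ne'
  have hb' : ∀ l, b l ≠ 0 := fun l => (hb l).ne
  have hLL := posDef_neg_dsSymJacLL hB hII hEL' hb hS
  have hULL : IsUnit (W.symJacLL (dsDQ EL b) EL).det := isUnit_det_of_posDef_neg₃ hLL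
  refine ⟨?_, ?_⟩
  · rw [dsRedStateMatrix_eq hB hU hEL' hEI' hb' T]
    refine isHurwitz_diagonal_mul_of_posDef_neg (fun k => ?_) (posDef_neg_dsMred hB hII hEL' hb hS)
    cases k with
    | inl i => exact div_pos (hEI i) (hτ i)
    | inr l => exact div_pos (by linarith [hb l]) (hT l)
  · obtain ⟨h11, -, -, -⟩ := dsJac_eq_scale_mul hB hU hEL' hEI' hb'
    rw [h11, det_mul, det_diagonal, IsUnit.mul_iff]
    exact ⟨isUnit_iff_ne_zero.2 (Finset.prod_ne_zero_iff.2 fun l _ => hEL' l), hULL⟩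

/-- **The certificate at a constant-power solution**: if `E_L ∈ ℝ^n_{>0}` solves (3.7) with constant-power
loads `Q_L` then `−[E_L]⁻¹J_red(∂Q/∂E = 0) = −B_red + [E_L]⁻²[Q_L]`; so Theorem 3.4's finite check
`−B_red + [E_L]⁻²[Q_L] ≻ 0` is exactly the hypothesis `hS` above.
[cite: SimpsonporcoDorflerBullo2017, proof of Theorem 3.2 («moreover» part) with the constant-power model; Theorem 3.4 / Appendix A (p0019 L66)] -/
theorem neg_symJacRed_zero_eq {Q EL : Fin n → ℝ} (hEL : ∀ l, EL l ≠ 0)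
    (hR : W.ReducedPowerFlow (zipLoad 0 0 Q) EL) :
    -W.symJacRed 0 EL = -W.Bred + diagonal fun l => Q l / EL l ^ 2 := by
  rw [symJacRed_of_reducedPowerFlow _ hEL hR]
  ext i j
  simp only [Matrix.neg_apply, Matrix.add_apply, Matrix.sub_apply, diagonal_apply, zipLoad,
    Pi.zero_apply, zero_div]
  split_ifs with h
  · subst h; ring
  · ring

end Linearisation

/-! ## §3a The blocks ARE the linearisation: the Fréchet derivative of the extended field -/

section Derivative

/-- **The extended field is differentiable, with the Jacobian read off (3.3), (3.16)**: at any `(E, b)`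
the map `(E, b) ↦ dsField Q_L E b` has Fréchet derivative
`(h, k) ↦ (J(E)h + ([E_L²]k, 0), −2[E_Lb]h_L − [E_L²]k)`, where `J(E) = [E]B + [BE] + D` is the Jacobian
(3.11′) of (3.3) with the load-model derivative `D_ll = ∂(b_lE_l²)/∂E_l = 2b_lE_l` (the companion's
`jac`). [cite: SimpsonporcoDorflerBullo2017, proof of Theorem 3.2 eq. (3.11′) («Jacobian matrix `J` of (3.3)») and Appendix A proof of Theorem 3.5 («the extended dynamics (3.3), (3.16)», p0019 L70–L71)] -/
theorem hasFDerivAt_dsField (Q : Fin n → ℝ) (E : Fin n ⊕ Fin m → ℝ) (b : Fin n → ℝ) :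
    ∃ D : ((Fin n ⊕ Fin m → ℝ) × (Fin n → ℝ)) →L[ℝ] ((Fin n ⊕ Fin m) ⊕ Fin n → ℝ),
      HasFDerivAt (fun p : (Fin n ⊕ Fin m → ℝ) × (Fin n → ℝ) => W.dsField Q p.1 p.2) D (E, b) ∧
      ∀ h k, D (h, k) = Sum.elim
          (W.jac (dsDQ (fun l => E (Sum.inl l)) b) E *ᵥ h + Sum.elim (fun l => E (Sum.inl l) ^ 2 * k l) 0)
          (fun l => -(2 * E (Sum.inl l) * b l) * h (Sum.inl l) - E (Sum.inl l) ^ 2 * k l) := by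
  -- coordinate functionals on the product space and the linear maps `p ↦ (Bp.1)_k`
  set P1 : Fin n ⊕ Fin m → (((Fin n ⊕ Fin m → ℝ) × (Fin n → ℝ)) →L[ℝ] ℝ) := fun k =>
    (ContinuousLinearMap.proj k : (Fin n ⊕ Fin m → ℝ) →L[ℝ] ℝ).comp
      (ContinuousLinearMap.fst ℝ (Fin n ⊕ Fin m → ℝ) (Fin n → ℝ)) with hP1def
  set P2 : Fin n → (((Fin n ⊕ Fin m → ℝ) × (Fin n → ℝ)) →L[ℝ] ℝ) := fun l =>
    (ContinuousLinearMap.proj l : (Fin n → ℝ) →L[ℝ] ℝ).comp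
      (ContinuousLinearMap.snd ℝ (Fin n ⊕ Fin m → ℝ) (Fin n → ℝ)) with hP2def
  set T : (Fin n ⊕ Fin m → ℝ) →L[ℝ] (Fin n ⊕ Fin m → ℝ) :=
    LinearMap.toContinuousLinearMap (Matrix.toLin' W.B) with hTdef
  set Brow : Fin n ⊕ Fin m → (((Fin n ⊕ Fin m → ℝ) × (Fin n → ℝ)) →L[ℝ] ℝ) := fun k =>
    (ContinuousLinearMap.proj k : (Fin n ⊕ Fin m → ℝ) →L[ℝ] ℝ).comp
      (T.comp (ContinuousLinearMap.fst ℝ (Fin n ⊕ Fin m → ℝ) (Fin n → ℝ))) with hBrowdef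
  have hfst : HasFDerivAt (Prod.fst : (Fin n ⊕ Fin m → ℝ) × (Fin n → ℝ) → (Fin n ⊕ Fin m → ℝ))
      (ContinuousLinearMap.fst ℝ (Fin n ⊕ Fin m → ℝ) (Fin n → ℝ)) (E, b) := hasFDerivAt_fst
  have hsnd : HasFDerivAt (Prod.snd : (Fin n ⊕ Fin m → ℝ) × (Fin n → ℝ) → (Fin n → ℝ))
      (ContinuousLinearMap.snd ℝ (Fin n ⊕ Fin m → ℝ) (Fin n → ℝ)) (E, b) := hasFDerivAt_snd
  have hP1 : ∀ k, HasFDerivAt (fun p : (Fin n ⊕ Fin m → ℝ) × (Fin n → ℝ) => p.1 k) (P1 k) (E, b) := by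
    intro k
    have h := (hasFDerivAt_apply k E).comp (E, b) hfst
    exact h
  have hP2 : ∀ l, HasFDerivAt (fun p : (Fin n ⊕ Fin m → ℝ) × (Fin n → ℝ) => p.2 l) (P2 l) (E, b) := by
    intro l
    have h := (hasFDerivAt_apply l b).comp (E, b) hsnd
    exact h
  have hT : HasFDerivAt (fun p : (Fin n ⊕ Fin m → ℝ) × (Fin n → ℝ) => W.B *ᵥ p.1)
      (T.comp (ContinuousLinearMap.fst ℝ (Fin n ⊕ Fin m → ℝ) (Fin n → ℝ))) (E, b) := by
    have h := T.hasFDerivAt.comp (E, b) hfst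
    refine h.congr_of_eventuallyEq (Eventually.of_forall fun p => ?_)
    simp [hTdef, Matrix.toLin'_apply]
  have hBrow : ∀ k, HasFDerivAt (fun p : (Fin n ⊕ Fin m → ℝ) × (Fin n → ℝ) => (W.B *ᵥ p.1) k)
      (Brow k) (E, b) := fun k => hasFDerivAt_pi'.1 hT k
  -- unfolding the functionals
  have eP1 : ∀ k h k', P1 k (h, k') = h k := fun k h k' => rfl
  have eP2 : ∀ l h k', P2 l (h, k') = k' l := fun l h k' => rfl
  have eBrow : ∀ k h k', Brow k (h, k') = (W.B *ᵥ h) k := fun k h k' => by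
    simp [hBrowdef, hTdef, Matrix.toLin'_apply]
  -- the candidate derivative, component by component
  set dQ : Fin n → ℝ := dsDQ (fun l => E (Sum.inl l)) b with hdQdef
  set G : (Fin n ⊕ Fin m) ⊕ Fin n → (((Fin n ⊕ Fin m → ℝ) × (Fin n → ℝ)) →L[ℝ] ℝ) :=
    Sum.elim
      (Sum.elim
        (fun l => E (Sum.inl l) • Brow (Sum.inl l)
          + ((W.B *ᵥ E) (Sum.inl l) + W.jacDiag dQ E (Sum.inl l)) • P1 (Sum.inl l)
          + (E (Sum.inl l) ^ 2) • P2 l)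
        (fun i => E (Sum.inr i) • Brow (Sum.inr i)
          + ((W.B *ᵥ E) (Sum.inr i) + W.jacDiag dQ E (Sum.inr i)) • P1 (Sum.inr i)))
      (fun l => (-(2 * E (Sum.inl l) * b l)) • P1 (Sum.inl l) - (E (Sum.inl l) ^ 2) • P2 l)
    with hGdef
  have eG : ∀ j h k', G j (h, k') = Sum.elim
      (W.jac dQ E *ᵥ h + Sum.elim (fun l => E (Sum.inl l) ^ 2 * k' l) 0)
      (fun l => -(2 * E (Sum.inl l) * b l) * h (Sum.inl l) - E (Sum.inl l) ^ 2 * k' l) j := by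
    intro j h k'
    rcases j with (l | i) | l
    · simp only [hGdef, Sum.elim_inl, _root_.add_apply, _root_.smul_apply, eBrow, eP1, eP2,
        smul_eq_mul, Pi.add_apply, jac_mulVec_apply]
      ring
    · simp only [hGdef, Sum.elim_inl, Sum.elim_inr, _root_.add_apply, _root_.smul_apply, eBrow, eP1,
        smul_eq_mul, Pi.add_apply, jac_mulVec_apply, Pi.zero_apply, add_zero]
      ring
    · simp only [hGdef, Sum.elim_inr, _root_.sub_apply, _root_.smul_apply, eP1, eP2, smul_eq_mul]
  refine ⟨ContinuousLinearMap.pi G, ?_, fun h k' => funext fun j => eG j h k'⟩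
  show HasFDerivAt (fun (p : (Fin n ⊕ Fin m → ℝ) × (Fin n → ℝ)) j => W.dsField Q p.1 p.2 j)
    (ContinuousLinearMap.pi G) (E, b)
  refine hasFDerivAt_pi.2 fun j => ?_
  rcases j with (l | i) | l
  · -- load row `l`: `b_lE_l² + E_l(BE)_l`
    have hsq := (hP1 (Sum.inl l)).mul (hP1 (Sum.inl l))
    have hQl := (hP2 l).mul hsq
    have hN := (hP1 (Sum.inl l)).mul (hBrow (Sum.inl l))
    have hsum := hQl.add hN
    refine (hsum.congr_of_eventuallyEq (Eventually.of_forall fun p => ?_)).congr_fderiv ?_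
    · simp only [dsField, Sum.elim_inl, closedLoop, ziLoad, Pi.zero_apply, Pi.add_apply,
        Pi.mul_apply]
      ring
    · refine ContinuousLinearMap.ext fun p => ?_
      obtain ⟨h, k'⟩ := p
      simp only [hGdef, Sum.elim_inl, _root_.add_apply, _root_.smul_apply, eBrow, eP1, eP2,
        smul_eq_mul, jacDiag, hdQdef, dsDQ, Pi.mul_apply]
      ring
  · -- inverter row `i`: `E_iK_i(E_i − E_i*) + E_i(BE)_i`
    have h1 := ((hP1 (Sum.inr i)).mul_const (W.K i)).mul ((hP1 (Sum.inr i)).sub_const (W.Estar i))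
    have hN := (hP1 (Sum.inr i)).mul (hBrow (Sum.inr i))
    have hsum := h1.add hN
    refine (hsum.congr_of_eventuallyEq (Eventually.of_forall fun p => ?_)).congr_fderiv ?_
    · simp only [dsField, Sum.elim_inl, closedLoop, Sum.elim_inr, Pi.add_apply, Pi.mul_apply]
    · refine ContinuousLinearMap.ext fun p => ?_
      obtain ⟨h, k'⟩ := p
      simp only [hGdef, Sum.elim_inl, Sum.elim_inr, _root_.add_apply, _root_.smul_apply, eBrow, eP1,
        smul_eq_mul, jacDiag]
      ring
  · -- shunt row `l`: `Q_l − E_l²b_l`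
    have hsq := (hP1 (Sum.inl l)).mul (hP1 (Sum.inl l))
    have hprod := hsq.mul (hP2 l)
    have hrow := hprod.const_sub (Q l)
    refine (hrow.congr_of_eventuallyEq (Eventually.of_forall fun p => ?_)).congr_fderiv ?_
    · simp only [dsField, Sum.elim_inr, Pi.mul_apply]
      ring
    · refine ContinuousLinearMap.ext fun p => ?_
      obtain ⟨h, k'⟩ := p
      simp only [hGdef, Sum.elim_inr, _root_.sub_apply, _root_.smul_apply, _root_.neg_apply,
        _root_.add_apply, eP1, eP2, smul_eq_mul, Pi.mul_apply]
      ring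

/-- **In the variables `(x_L | x_I, x_b)` the derivative of the extended field at the state
`(E_L, W₂(E_L, E_I*), b)` has the block form `[[𝒥_LL, 𝒥_Ld], [𝒥_dL, 𝒥_dd]]`** (rows: load | inverter,
shunt) — i.e. the blocks `dsJLL`, `dsJLd`, `dsJdL`, `dsJdd` of §3 ARE the linearisation of (3.3), (3.16).
[cite: SimpsonporcoDorflerBullo2017, Appendix A proof of Theorem 3.5 («applying the proof methodologies of Theorems 3.2 and 3.4 to the extended dynamics (3.3), (3.16)», p0019 L70–L71)] -/
theorem dsField_fderiv_blocks (EL b : Fin n → ℝ) (hL : Fin n → ℝ) (hI : Fin m → ℝ) (k : Fin n → ℝ) :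
    Sum.elim
        (W.jac (dsDQ EL b) (W.liftState EL) *ᵥ Sum.elim hL hI + Sum.elim (fun l => EL l ^ 2 * k l) 0)
        (fun l => -(2 * EL l * b l) * hL l - EL l ^ 2 * k l)
      = Sum.elim
          (Sum.elim (W.dsJLL EL b *ᵥ hL + W.dsJLd EL b *ᵥ Sum.elim hI k)
            (fun i => (W.dsJdL EL b *ᵥ hL + W.dsJdd EL b *ᵥ Sum.elim hI k) (Sum.inl i)))
          (fun l => (W.dsJdL EL b *ᵥ hL + W.dsJdd EL b *ᵥ Sum.elim hI k) (Sum.inr l)) := by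
  have hJ : W.jac (dsDQ EL b) (W.liftState EL) = Matrix.fromBlocks (W.dsJLL EL b)
      (W.jacLI (dsDQ EL b) (W.liftState EL)) (W.jacIL (dsDQ EL b) (W.liftState EL))
      (W.jacII (dsDQ EL b) (W.liftState EL)) :=
    (Matrix.fromBlocks_toBlocks _).symm
  have hcompl : (Sum.elim hL hI ∘ Sum.inl) = hL := funext fun l => rfl
  have hcompr : (Sum.elim hL hI ∘ Sum.inr) = hI := funext fun i => rfl
  have hcompl' : (Sum.elim hI k ∘ Sum.inl) = hI := funext fun i => rfl
  have hcompr' : (Sum.elim hI k ∘ Sum.inr) = k := funext fun l => rfl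
  rw [hJ, Matrix.fromBlocks_mulVec, hcompl, hcompr]
  funext j
  rcases j with (l | i) | l
  · simp only [Sum.elim_inl, Pi.add_apply, dsJLd, Matrix.fromCols_mulVec, hcompl', hcompr',
      mulVec_diagonal]
    ring
  · simp only [Sum.elim_inl, Sum.elim_inr, Pi.add_apply, dsJdL, dsJdd, Matrix.fromRows_mulVec,
      Matrix.fromBlocks_mulVec, hcompl', hcompr', Matrix.zero_mulVec, Pi.zero_apply, add_zero]
  · simp only [Sum.elim_inr, Pi.add_apply, dsJdL, dsJdd, Matrix.fromRows_mulVec,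
      Matrix.fromBlocks_mulVec, hcompl', hcompr', Matrix.zero_mulVec, zero_add,
      mulVec_diagonal, Pi.neg_apply, Matrix.neg_mulVec]
    ring

/-- **Corollary: the derivative of the extended field at `(E_L, W₂(E_L, E_I*), b)` in block form.**
[cite: SimpsonporcoDorflerBullo2017, Appendix A proof of Theorem 3.5 (p0019 L70–L71) with eq. (3.11′)] -/
theorem hasFDerivAt_dsField_liftState (Q EL b : Fin n → ℝ) :
    ∃ D : ((Fin n ⊕ Fin m → ℝ) × (Fin n → ℝ)) →L[ℝ] ((Fin n ⊕ Fin m) ⊕ Fin n → ℝ),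
      HasFDerivAt (fun p : (Fin n ⊕ Fin m → ℝ) × (Fin n → ℝ) => W.dsField Q p.1 p.2) D
          (W.liftState EL, b) ∧
      ∀ hL hI k, D (Sum.elim hL hI, k) = Sum.elim
          (Sum.elim (W.dsJLL EL b *ᵥ hL + W.dsJLd EL b *ᵥ Sum.elim hI k)
            (fun i => (W.dsJdL EL b *ᵥ hL + W.dsJdd EL b *ᵥ Sum.elim hI k) (Sum.inl i)))
          (fun l => (W.dsJdL EL b *ᵥ hL + W.dsJdd EL b *ᵥ Sum.elim hI k) (Sum.inr l)) := by
  obtain ⟨D, hD, hval⟩ := W.hasFDerivAt_dsField Q (W.liftState EL) b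
  refine ⟨D, hD, fun hL hI k => ?_⟩
  rw [hval, ← dsField_fderiv_blocks]
  rfl

end Derivative

/-! ## §4 Theorem 3.5 assembled at the reduced-matrix tier -/

variable {W} in
/-- **Theorem 3.5 (Stability with Dynamic Shunt Loads), reduced-matrix tier.**  Data as in Proposition
7.2 (`B` symmetric, off-diagonal `≥ 0`, zero row sums, `−(B + blkdiag(0, K_I)) ≻ 0`, `K_i ≤ 0`,
`E_i* > 0`), `τ_i > 0`, shunt time constants `T_l > 0`, and Theorem 3.3 (ii) at `I_shunt = 0`
(`B_redE_L* < 0`).  Then for ALL SUFFICIENTLY SMALL demands `Q_L`, WHENEVER they are inductive (`Q_L < 0`,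
the print's standing assumption): `(E_L^{DS}, E_I^{DS}) ∈ ℝ^{n+m}_{>0}` and `b^{DS} ∈ ℝ^n_{<0}` form an
equilibrium of (3.3), (3.16), the Theorem 3.4 certificate `−B_red + [E_L^{DS}]⁻²[Q_L] ≻ 0` holds, and
the reduced matrix of the extended DAE linearised at this equilibrium is HURWITZ with invertible
algebraic block (the equilibrium formulas, expansion and local uniqueness are `theorem_3_5_equilibrium`).
[cite: SimpsonporcoDorflerBullo2017, §3.3 Theorem 3.5 (p0012 L28–L38) and Appendix A (p0019 L68–L71), with Theorem 3.2, Theorem 3.4, Proposition 7.2; HornJohnson2013, §7.6 Thm. 7.6.1 (a)] -/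
theorem theorem_3_5_redStateMatrix (hB : W.B.IsSymm) (hoff : ∀ k k', k ≠ k' → 0 ≤ W.B k k')
    (hrowB : ∀ k, ∑ k', W.B k k' = 0) (hM : (-(W.B + Matrix.fromBlocks 0 0 0 (diagonal W.K))).PosDef)
    (hK : ∀ i, W.K i ≤ 0) (hEs : ∀ i, 0 < W.Estar i) (hτ : ∀ i, 0 < W.τ i) {T : Fin n → ℝ}
    (hT : ∀ l, 0 < T l) (hI : ∀ l, W.redSource l < 0) :
    ∀ᶠ Q in 𝓝 (0 : Fin n → ℝ), (∀ l, Q l < 0) →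
      (∀ k, 0 < W.dsState Q k) ∧ (∀ l, W.dsShunt Q l < 0) ∧
      W.IsDSEquilibrium Q (W.dsState Q) (W.dsShunt Q) ∧
      (-W.Bred + diagonal fun l => Q l / W.dsVoltage Q l ^ 2).PosDef ∧
      IsHurwitz (W.dsRedStateMatrix (W.dsVoltage Q) (W.dsShunt Q) T) ∧
      IsUnit (W.dsJLL (W.dsVoltage Q) (W.dsShunt Q)).det := by
  obtain ⟨⟨hred, hZ0⟩, -, -, -⟩ := proposition_7_2 hB hoff hrowB hM hK hEs
  have hII := posDef_neg_BIIK_of_posDef_aug hM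
  have hA : (-(W.Bred + diagonal (0 : Fin n → ℝ))).PosDef := by rwa [diagonal_zero', add_zero]
  have hZ : IsZMatrix (-(W.Bred + diagonal (0 : Fin n → ℝ))) := by rwa [diagonal_zero', add_zero]
  have hI' : ∀ l, W.redSource l < (0 : Fin n → ℝ) l := fun l => hI l
  obtain ⟨hpos0, -, -, -⟩ := theorem_3_3_ziLoads hA hZ hI'
  have hE0 : ∀ l, W.ziVoltage 0 0 l ≠ 0 := fun l => (hpos0 l).ne'
  obtain ⟨-, -, hev, -, -, -⟩ := theorem_3_5_equilibrium hB hoff hrowB hM hK hEs hI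
  obtain ⟨-, -, hsol, -⟩ := W.theorem_3_4_zipLoads hA hZ hI'
  filter_upwards [hev, hsol, W.eventually_posDef_zipCertificate hA hE0] with Q h1 h2 hcert hQ
  obtain ⟨hpos, heq, hsign⟩ := h1
  obtain ⟨hposL, hR, -⟩ := h2
  have hb : ∀ l, W.dsShunt Q l < 0 := fun l => (hsign l).2 (hQ l)
  have hcert' : (-W.Bred + diagonal fun l => Q l / W.dsVoltage Q l ^ 2).PosDef := by
    rw [diagonal_zero', add_zero] at hcert
    exact hcert
  have hEL : ∀ l, 0 < W.dsVoltage Q l := hposL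
  have hEI : ∀ i, 0 < W.invVoltage (W.dsVoltage Q) i := fun i => hpos (Sum.inr i)
  have hS : (-W.symJacRed 0 (W.dsVoltage Q)).PosDef := by
    rw [neg_symJacRed_zero_eq (fun l => (hEL l).ne') hR]
    exact hcert'
  exact ⟨hpos, hb, heq, hcert', dsRedStateMatrix_isHurwitz hB hII hτ hT hEL hEI hb hS⟩

variable {W} in
/-- **Theorem 3.5, reduced-matrix tier, from network data** (connected inductive network
`B = susceptanceMatrix w`, `w` symmetric `≥ 0`, `BranchConnected w`; `K_i < 0`, `E_i* > 0`, `τ_i > 0`,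
`T_l > 0`, at least one inverter; every load bus has a line to some inverter bus — which gives Theorem
3.3 (ii) at `I_shunt = 0`). [cite: SimpsonporcoDorflerBullo2017, §3.3 Theorem 3.5 with §7 Lemma 7.1 and Proposition 7.2] -/
theorem theorem_3_5_redStateMatrix_of_network {w : Fin n ⊕ Fin m → Fin n ⊕ Fin m → ℝ}
    (hw : ∀ i j, w i j = w j i) (hw0 : ∀ i j, 0 ≤ w i j) (hconn : BranchConnected w)
    (hBw : W.B = susceptanceMatrix w) (hK : ∀ i, W.K i < 0) (hm : 0 < m) (hEs : ∀ i, 0 < W.Estar i)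
    (hτ : ∀ i, 0 < W.τ i) {T : Fin n → ℝ} (hT : ∀ l, 0 < T l)
    (hline : ∀ l : Fin n, ∃ i : Fin m, 0 < w (Sum.inl l) (Sum.inr i)) :
    ∀ᶠ Q in 𝓝 (0 : Fin n → ℝ), (∀ l, Q l < 0) →
      (∀ k, 0 < W.dsState Q k) ∧ (∀ l, W.dsShunt Q l < 0) ∧
      W.IsDSEquilibrium Q (W.dsState Q) (W.dsShunt Q) ∧
      (-W.Bred + diagonal fun l => Q l / W.dsVoltage Q l ^ 2).PosDef ∧
      IsHurwitz (W.dsRedStateMatrix (W.dsVoltage Q) (W.dsShunt Q) T) ∧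
      IsUnit (W.dsJLL (W.dsVoltage Q) (W.dsShunt Q)).det := by
  have hB : W.B.IsSymm := by rw [hBw]; exact susceptanceMatrix_isSymm hw
  have hoff : ∀ k k', k ≠ k' → 0 ≤ W.B k k' := fun k k' hkk' => by
    rw [hBw]; exact susceptanceMatrix_offDiag_nonneg hw0 hkk'
  have hrowB : ∀ k, ∑ k', W.B k k' = 0 := fun k => by
    rw [hBw]; exact sum_susceptanceMatrix_row w k
  have hM := posDef_neg_aug_of_branchConnected hw hw0 hconn hBw hK hm
  have hII := posDef_neg_BIIK_of_posDef_aug hM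
  have hI : ∀ l, W.redSource l < 0 := by
    intro l
    obtain ⟨i, hi⟩ := hline l
    refine redSource_neg_of_exists_line hoff hII hK hEs ⟨i, ?_⟩
    rw [hBw, susceptanceMatrix_apply_ne w (by simp)]
    exact hi
  exact theorem_3_5_redStateMatrix hB hoff hrowB hM (fun i => (hK i).le) hEs hτ hT hI

end QuadDroopNetwork

end Literature.MathematicalPhysics.PowerSystems
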